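import Literature.IUT.LogVolume.Corollary22PartIIICore
import HarnessLib

/-!
# [IUTchIV] Corollary 2.2 (iii) — PROVED for every `H_unif` above an absolute threshold

Mochizuki, *Inter-universal Teichmüller theory IV*, RIMS manuscript (Apr. 2020; = PRIMS **57** (2021)),
Cor. 2.2 (iii), p. 43.  Proof-only companion of S3's `Corollary22Statement.lean` (repaired version p405792:
the exceptional set is counted through minimal polynomials, `HasFinitelyManyPoints`): from the two
ingredients of `Corollary22PartIIICore.lean` — the `ε_E`-threshold computation and the finiteness of the
small-`log(q^∀)` locus — we obtain `Cor22.PartIII D H_unif` for EVERY compactly bounded `K_V` on which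
`ht_{ω_X(D)} ≲ (1/6)·log(q^∀)` (in particular whenever `Cor22.PartI D` holds) and EVERY `H_unif ≥ H₃`, with
`H₃ > 0` ABSOLUTE (p. 43: "`H_unif` … independent of `K_V`!").  Also: `PartIII` and `PartII` are monotone
in `H_unif`, whence the ASSEMBLY `exists_corollary22_of_partI_partII`: if (i) holds for every `K_V` with
the hypotheses of Cor. 2.2 and (ii) holds for every such `K_V` with some uniform `H_II`, then
`∃ H_unif, Cor22.Corollary22 H_unif` (take `H_unif := max(H_II, H₃, 1)`) — i.e. the kernel debt of
Cor. 2.2 is reduced to (i) [classical] and (ii) [Theorem 1.10 + existence of initial Θ-data].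

Classical (real analysis + Northcott); uses neither (∗^{j-inv}) nor Theorem 1.10 nor any Θ-data; nothing
here takes a side on [IUTchIII] Cor. 3.12 or asserts abc.  No new definitions.
-/

noncomputable section

namespace Literature.IUT.LogVolume

namespace Cor22

open Real NumberField Literature.NumberTheory.DiophantineGeometry.GenEll

/-! ## Corollary 2.2 (iii) itself, for every `H_unif` above an absolute threshold -/

/-- **[IUTchIV] Cor. 2.2 (iii) PROVED (modulo the bounded-discrepancy input of (i))**, p. 43: there is an
ABSOLUTE `H₃ > 0` ("`H_unif` … independent of `K_V`!") such that for every compactly bounded `K_V` on which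
`ht_{ω_X(D)} ≲ (1/6)·log(q^∀)` and every `H_unif ≥ H₃`, statement (iii) holds as typed (`Cor22.PartIII`):
with `H_K := 1` and `Exc_{ε,d} := {P ∈ K_V ∩ U_X(ℚ̄)^{≤d} | log(q^∀)(P) ≤ H_unif·ε^{−3}·ε_d^{−3}·d^{4+ε_d}}`
(finitely many points by `hasFinitelyManyPoints_logQForall_le`; off it `ε_E ≤ ε` by
`exists_threshold_epsilonE_le`).  No hypothesis (∗^{j-inv}), no Theorem 1.10, no Θ-data.
[claim: Mochizuki2012, status: disputed] -/
theorem exists_threshold_partIII_of_bdLe :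
    ∃ H₃ : ℝ, 0 < H₃ ∧ ∀ D : CBData,
      BDLe D.toSet NFPoint.ht (fun P => 1 / 6 * logQForall P) →
        ∀ Hunif : ℝ, H₃ ≤ Hunif → PartIII D Hunif := by
  obtain ⟨H₃, hH₃, hthr⟩ := exists_threshold_epsilonE_le
  refine ⟨H₃, hH₃, fun D hht Hunif hH => ⟨1, one_pos, fun d hd εd h0 h1 ε e0 e1 => ?_⟩⟩
  set B : ℝ := Hunif * ε ^ (-(3 : ℝ)) * εd ^ (-(3 : ℝ)) * (d : ℝ) ^ (4 + εd) with hB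
  refine ⟨{P | P ∈ D.toSet ∩ UPle d ∧ logQForall P ≤ B},
    hasFinitelyManyPoints_logQForall_le D hht d B, fun P hP => hP.1.2, fun P hP => ?_, fun P hP hPE => ?_⟩
  · have h := hP.2
    linarith
  · have hlt : B < logQForall P := by
      by_contra hle
      exact hPE ⟨hP, not_lt.mp hle⟩
    exact hthr Hunif hH d hd εd h0 h1 ε e0 e1 P hlt.le

/-- **[IUTchIV] Cor. 2.2 (iii) from Cor. 2.2 (i)**: for every `K_V` for which the equalities of BD-classes of
Cor. 2.2 (i) hold (`Cor22.PartI D` — classical; abc-iut-S3's `Corollary22PartI.lean`, `Corollary22HeightJ.lean`,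
`Corollary22TwoAdic.lean` prove its three conjuncts) and
every `H_unif ≥ H₃`, `Cor22.PartIII D H_unif`. [claim: Mochizuki2012, status: disputed] -/
theorem exists_threshold_partIII_of_partI :
    ∃ H₃ : ℝ, 0 < H₃ ∧ ∀ D : CBData, PartI D → ∀ Hunif : ℝ, H₃ ≤ Hunif → PartIII D Hunif := by
  obtain ⟨H₃, hH₃, h⟩ := exists_threshold_partIII_of_bdLe
  exact ⟨H₃, hH₃, fun D hI Hunif hH => h D (hI.2.2.symm.trans hI.2.1.symm).bdLe Hunif hH⟩

/-- `Cor22.PartIII` is MONOTONE in `H_unif` (a larger uniform constant only enlarges the admissible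
exceptional bound), so the assembler of `Cor22.Corollary22 H_unif` may take `H_unif := max(H_II, H₃)`.
[claim: Mochizuki2012, status: disputed] -/
theorem partIII_mono {D : CBData} {H H' : ℝ} (hHH' : H ≤ H') (h : PartIII D H) : PartIII D H' := by
  obtain ⟨HK, hHK, h⟩ := h
  refine ⟨HK, hHK, fun d hd εd h0 h1 ε e0 e1 => ?_⟩
  obtain ⟨Exc, hfin, hsub, hB, hE⟩ := h d hd εd h0 h1 ε e0 e1
  refine ⟨Exc, hfin, hsub, fun P hP => ?_, hE⟩
  have hM : 0 ≤ ε ^ (-(3 : ℝ)) * εd ^ (-(3 : ℝ)) * (d : ℝ) ^ (4 + εd) :=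
    mul_nonneg (mul_nonneg (Real.rpow_nonneg e0.le _) (Real.rpow_nonneg h0.le _))
      (Real.rpow_nonneg (Nat.cast_nonneg d) _)
  have := hB P hP
  have hmono : H * ε ^ (-(3 : ℝ)) * εd ^ (-(3 : ℝ)) * (d : ℝ) ^ (4 + εd) ≤
      H' * ε ^ (-(3 : ℝ)) * εd ^ (-(3 : ℝ)) * (d : ℝ) ^ (4 + εd) := by
    have key := mul_le_mul_of_nonneg_right hHH' hM
    calc H * ε ^ (-(3 : ℝ)) * εd ^ (-(3 : ℝ)) * (d : ℝ) ^ (4 + εd)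
        = H * (ε ^ (-(3 : ℝ)) * εd ^ (-(3 : ℝ)) * (d : ℝ) ^ (4 + εd)) := by ring
      _ ≤ H' * (ε ^ (-(3 : ℝ)) * εd ^ (-(3 : ℝ)) * (d : ℝ) ^ (4 + εd)) := key
      _ = H' * ε ^ (-(3 : ℝ)) * εd ^ (-(3 : ℝ)) * (d : ℝ) ^ (4 + εd) := by ring
  linarith

/-- `Cor22.PartII` is MONOTONE in `H_unif` as well (the uniform constant only enters the admissible bound
for `log(q^∀)` on the exceptional set `Exc_d`). [claim: Mochizuki2012, status: disputed] -/
theorem partII_mono {D : CBData} {H H' : ℝ} (hHH' : H ≤ H') (h : PartII D H) : PartII D H' := by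
  obtain ⟨CK, HK, hCK, hHK, h⟩ := h
  refine ⟨CK, HK, hCK, hHK, fun d hd εd h0 h1 => ?_⟩
  obtain ⟨Exc, hfin, hsub, hCM, hB, hC⟩ := h d hd εd h0 h1
  refine ⟨Exc, hfin, hsub, hCM, fun P hP => ?_, hC⟩
  have hM : 0 ≤ εd ^ (-(3 : ℝ)) * (d : ℝ) ^ (4 + εd) :=
    mul_nonneg (Real.rpow_nonneg h0.le _) (Real.rpow_nonneg (Nat.cast_nonneg d) _)
  have := hB P hP
  have hmono : H * εd ^ (-(3 : ℝ)) * (d : ℝ) ^ (4 + εd) ≤ H' * εd ^ (-(3 : ℝ)) * (d : ℝ) ^ (4 + εd) := by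
    have key := mul_le_mul_of_nonneg_right hHH' hM
    calc H * εd ^ (-(3 : ℝ)) * (d : ℝ) ^ (4 + εd) = H * (εd ^ (-(3 : ℝ)) * (d : ℝ) ^ (4 + εd)) := by ring
      _ ≤ H' * (εd ^ (-(3 : ℝ)) * (d : ℝ) ^ (4 + εd)) := key
      _ = H' * εd ^ (-(3 : ℝ)) * (d : ℝ) ^ (4 + εd) := by ring
  linarith

/-- **Assembly of [IUTchIV] Cor. 2.2 from its parts** (pp. 41–43): if (i) holds for every `K_V` satisfying
the hypotheses of Cor. 2.2 and (ii) holds for every such `K_V` with SOME uniform constant `H_II`, then —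
(iii) being PROVED above for all `H_unif ≥ H₃` from (i) — there is an `H_unif` (namely `max(H_II, H₃, 1)`)
with `Cor22.Corollary22 H_unif`.  This reduces the kernel debt of Cor. 2.2 to (i) [classical] and (ii)
[Theorem 1.10 + existence of initial Θ-data]; nothing is asserted about either here.
[claim: Mochizuki2012, status: disputed] -/
theorem exists_corollary22_of_partI_partII (hI : ∀ D : CBData, Hypotheses D → PartI D) {HII : ℝ}
    (hII : ∀ D : CBData, Hypotheses D → PartII D HII) : ∃ Hunif : ℝ, Corollary22 Hunif := by
  obtain ⟨H₃, hH₃, h3⟩ := exists_threshold_partIII_of_partI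
  refine ⟨max (max HII H₃) 1, lt_of_lt_of_le one_pos (le_max_right _ _), fun D hD => ?_⟩
  have hI' := hI D hD
  refine ⟨hI', partII_mono (le_trans (le_max_left _ _) (le_max_left _ _)) (hII D hD),
    h3 D hI' _ (le_trans (le_max_right _ _) (le_max_left _ _))⟩

end Cor22

end Literature.IUT.LogVolume

end
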